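import Summits.BirchSwinnertonDyer.BirchSwinnertonDyer.Theorems.RamifiedHeegnerPairRamifiedPairUpperBoundOfUpperHalfOverK
import HarnessLib

/-!
# Route `RamifiedHeegnerPair` — the twist pair READ OVER THE 3-RAMIFIED FIELD, POINTWISE in `(W, V, d)`:
# the pair inequalities at `(W, V)` give the two halves of `BSD_p(W_K/K)`, and both give `BSD(W_K/K, p)`

HONEST FRAMING. Theorems only (tribunal-w witness seat bsd-trib-w-rhp g6, `--supports
stmt-BirchSwinnertonDyer-23191`). BSD is NOT proved; nothing about the cruxes X1 `RamifiedPairLowerBound`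
(stmt-23191, deciding) / X2 `RamifiedPairUpperBound` (stmt-23192) in general is claimed. Every statement is
a bookkeeping implication under two DISPLAYED published inputs of the route's line `birth`: modularity
`hE : hasEntireLFunction_rat` and Milne 1972 Thm. 1 in Dokchitser–Dokchitser's model-free form
`hMilne : Milne1972.bsdQuotient_baseChange_quadratic_anyModel` (and, in §2, Gross–Zagier–Kolyvagin `hGZK`,
the route's `PublishedInputGZK`).

WHY THIS FILE. The two lead provers of the route (rhp-p1 on X1, rhp-p2 on X2, 2026-08-28) ended with
«promote-stub»: modulo the displayed published inputs each crux is EQUIVALENT to ONE statement over the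
3-ramified field `K = ℚ(√d)` — `stub_lowerHalfOverK` («`#Ш_an(W_K/K)` is a rational `q` with
`ord₃ q ≤ ord₃ #Ш(W_K/K)`») resp. `stub_upperHalfOverK` (the reverse inequality) — by the landed pairs
`RamifiedPairLowerBound.ramifiedPairLowerBound_of_lowerHalfOverK` / `lowerHalfOverK_of_ramifiedPairLowerBound`
and `RamifiedPairUpperBound.ramifiedPairUpperBound_of_upperHalfOverK` / `upperHalfOverK_of_ramifiedPairUpperBound`.
Those converses consume the GLOBAL crux, so they cannot read an INSTANCE of the crux (a witness rung) over
`K`. This file makes the bookkeeping POINTWISE in `(W, V, d)` and prime-generic: (§1) the identity `(★)`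
`#Ш_an(W_K)·#Ш(W)·#Ш(V) = #Ш_an(W)·#Ш_an(V)·#Ш(W_K)` read in `ℚ` on the model `W_K`
(`analyticSha_baseChange_eq_ratCast`: `Ш(W_K)` finite and `#Ш_an(W_K/K) = q q' #Ш(W_K)/(#Ш(W) #Ш(V))`),
for EVERY quadratic `K = ℚ(θ)`, `θ² = d`, `d` no rational square; whence the pair's LOWER inequality at `p`
gives the lower half of `BSD_p(W_K/K)` (`lowerHalfOverK_of_pairLower`), the UPPER inequality the upper
(Euler-system) half (`upperHalfOverK_of_pairUpper`), and both together Miller's `BSD(W_K/K, p)` = the tree's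
`BSDpOver (W.baseChange K) p` (`bsdpOver_baseChange_of_pair`); (§2) in the registered stubs' literal
currency at `p = 3`: the X1 (X2) body AT `(W, V, d)` implies the `stub_lowerHalfOverK` (`stub_upperHalfOverK`)
body AT `(W, V, d)` (`lowerHalfOverKAt_of_pairLowerAt`, `upperHalfOverKAt_of_pairUpperAt`). The sequel
`RamifiedHeegnerPairRungOverKPairs.lean` applies §1–§2 to the certified witness pairs `(308025h1, 1369c1, -15)`,
`(475650cs1, 10570k1, -15)` and obtains `BSD₃(E/ℚ(√-15))` for `E = 308025h1`, `475650cs1` under the rungs'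
displayed binders — the route's over-`K` object `A = E/K` (3 RAMIFIED in `K`, `E_K` good supersingular above
`3`, `r_an(E/K) = 1`) at instances.

THE BOOKKEEPING (all tree theorems, as in the X1/X2 files): `θ ∉ ℚ` since `d` is no rational square (in §2:
`ord₃ d = 1`, `SolventPairLowerBound.not_isSquare_ratCast_of_padicValInt_eq_one`); a model of `W^(d)` is a
model of `W^(d_K)` (`SolventPairLowerBound.exists_variableChange_quadraticTwist_discr`); Milne's identity on
the model `W_K` gives `Ш(W_K)` finite and the Weil-restriction equation; Artin formalism gives `(★)` and
`#Ш_an(W_K) = q q' #Ш(W_K)/(#Ш(W) #Ш(V))` (`AdditivePotMult.exists_shaAnOverC_eq_of_rat`; `analyticSha`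
is `shaAnOverC` by `rfl`); `#Ш_an ≠ 0` over `ℚ` (`AdditivePotMult.shaAn_ne_zero`); valuations by
`RamifiedPairLowerBound.padicValRat_le_of_mul_eq` / `RamifiedPairUpperBound.padicValRat_natCast_le_of_mul_eq`;
`BSDpOver ↔ (∃ q, #Ш_an = q ∧ ord_p q = ord_p #Ш)` for finite `Ш` (`bsdpOver_iff_of_shaFinite`).

References: J. S. Milne, Invent. Math. 17 (1972) Thm. 1 [Milne1972ArithmeticAV]; T. Dokchitser,
V. Dokchitser, Ann. of Math. 172 (2010) §2.1 [DokchitserDokchitserAnnals2010]; R. L. Miller, LMS J. Comput.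
Math. 14 (2011) §1 Def. 1.1 [Miller2011LMS]; B. Gross, D. Zagier, Invent. Math. 84 (1986) [GrossZagier1986];
V. A. Kolyvagin, *Euler systems* (1990) [KolyvaginEulerSystems1990].
-/

-- D-0017: single-problem summit, so `Summit.BirchSwinnertonDyer.BirchSwinnertonDyer.…` repeats a namespace BY DESIGN.
set_option linter.dupNamespace false
set_option autoImplicit false

noncomputable section

open scoped Classical

open WeierstrassCurve Literature.NumberTheory.EllipticCurves
  Literature.NumberTheory.EllipticCurves.Rank1Residual

namespace Summit.BirchSwinnertonDyer.BirchSwinnertonDyer.Theorems.RamifiedHeegnerPairRungOverK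

/-! ## §1 The identity `(★)` on the model `W_K`, pointwise in `(W, V, d)`, and the three readings at `p` -/

/-- **`(★)` in `ℚ` on `W_K`, pointwise.** For a globally minimal `W/ℚ`, a globally minimal model `V` of
`W^(d)` with `d` not a rational square, `Ш(W)`, `Ш(V)` finite and `#Ш_an(W) = q`, `#Ш_an(V) = q'` rational,
and ANY quadratic field `K = ℚ(θ)` with `θ² = d`: GIVEN modularity (`hE`) and Milne 1972 Thm. 1 in
model-free form (`hMilne`), `Ш(W_K/K)` is finite, `q, q' ≠ 0`, and
`#Ш_an(W_K/K) = analyticSha (W.baseChange K) = q·q'·#Ш(W_K)/(#Ш(W)·#Ш(V))`.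
[cite: Milne1972ArithmeticAV, §1 Thm. 1] [cite: DokchitserDokchitserAnnals2010, §2.1: statement 2.1, Notation, proof of Thm. 2.3]
[cite: Miller2011LMS, §1 and Def. 1.1 (arXiv:1010.2431 p. 3)] -/
theorem analyticSha_baseChange_eq_ratCast (hE : hasEntireLFunction_rat)
    (hMilne : Milne1972.bsdQuotient_baseChange_quadratic_anyModel)
    (W : WeierstrassCurve ℚ) [W.IsElliptic] [W.IsGloballyMinimal]
    (V : WeierstrassCurve ℚ) [V.IsElliptic] [V.IsGloballyMinimal] {d : ℤ} (hd : ¬ IsSquare (d : ℚ))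
    (hC : ∃ C : WeierstrassCurve.VariableChange ℚ, C • W.quadraticTwist (d : ℚ) = V)
    (hWfin : W.ShaFinite) (hVfin : V.ShaFinite)
    {q q' : ℚ} (hq : shaAn W = (q : ℂ)) (hq' : shaAn V = (q' : ℂ))
    (K : Type) [Field K] [NumberField K] {θ : K} (h2 : Module.finrank ℚ K = 2) (hθ : θ ^ 2 = (d : K)) :
    (W.baseChange K).ShaFinite ∧ q ≠ 0 ∧ q' ≠ 0 ∧
      analyticSha (W.baseChange K) =
        ((q * q' * (W.baseChange K).shaOrder / (W.shaOrder * V.shaOrder) : ℚ) : ℂ) := by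
  -- `θ ∉ ℚ`: `d` is not a rational square
  have hθK : θ ∉ Set.range (algebraMap ℚ K) := by
    rintro ⟨r, hr⟩
    apply hd
    refine ⟨r, ?_⟩
    apply (algebraMap ℚ K).injective
    rw [map_mul, hr, ← sq, hθ, map_intCast]
  -- `V` is a model of the twist by the discriminant `d_K = d q²`
  have hVd : ∃ C : WeierstrassCurve.VariableChange ℚ,
      C • W.quadraticTwist (NumberField.discr K : ℚ) = V :=
    SolventPairLowerBound.exists_variableChange_quadraticTwist_discr h2 hθ hθK W V hC
  -- the `K`-model `W_K`
  haveI : (W.baseChange K).IsElliptic := by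
    rw [WeierstrassCurve.baseChange]; infer_instance
  have hV' : ∃ C : WeierstrassCurve.VariableChange K, C • W.baseChange K = W.baseChange K :=
    ⟨1, one_smul _ _⟩
  -- Milne: `Ш(W_K)` finite and the Weil-restriction identity on the model `W_K`
  obtain ⟨hKfin, hWR⟩ := hMilne W K h2 V hVd (W.baseChange K) hV' hWfin hVfin
  -- `#Ш_an(W_K)` is the rational `q q' #Ш(W_K) / (#Ш(W) #Ш(V))`
  have hqK := Summit.BirchSwinnertonDyer.Rank1Residual.AdditivePotMult.exists_shaAnOverC_eq_of_rat
    W K V (W.baseChange K) hE h2 hVd hV' hWfin hVfin hWR hq hq'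
  -- non-vanishing over `ℚ`
  have hq0 : q ≠ 0 := by
    intro h0
    apply Summit.BirchSwinnertonDyer.Rank1Residual.AdditivePotMult.shaAn_ne_zero W hE
    rw [hq, h0, Rat.cast_zero]
  have hq0' : q' ≠ 0 := by
    intro h0
    apply Summit.BirchSwinnertonDyer.Rank1Residual.AdditivePotMult.shaAn_ne_zero V hE
    rw [hq', h0, Rat.cast_zero]
  exact ⟨hKfin, hq0, hq0', hqK⟩

/-- **Lower reading at `p`.** In the situation of `analyticSha_baseChange_eq_ratCast`, the pair's LOWER
inequality `ord_p #Ш_an(W) + ord_p #Ш_an(V) ≤ ord_p #Ш(W) + ord_p #Ш(V)` (the X1 body's conclusion at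
`(W, V)`) gives the lower half of `BSD_p(W_K/K)`: `#Ш_an(W_K/K)` is a rational `qK` with
`ord_p qK ≤ ord_p #Ш(W_K/K)`. [cite: Milne1972ArithmeticAV, §1 Thm. 1]
[cite: Miller2011LMS, §1 and Def. 1.1 (arXiv:1010.2431 p. 3)] -/
theorem lowerHalfOverK_of_pairLower (p : ℕ) [Fact p.Prime] (hE : hasEntireLFunction_rat)
    (hMilne : Milne1972.bsdQuotient_baseChange_quadratic_anyModel)
    (W : WeierstrassCurve ℚ) [W.IsElliptic] [W.IsGloballyMinimal]
    (V : WeierstrassCurve ℚ) [V.IsElliptic] [V.IsGloballyMinimal] {d : ℤ} (hd : ¬ IsSquare (d : ℚ))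
    (hC : ∃ C : WeierstrassCurve.VariableChange ℚ, C • W.quadraticTwist (d : ℚ) = V)
    (hWfin : W.ShaFinite) (hVfin : V.ShaFinite)
    {q q' : ℚ} (hq : shaAn W = (q : ℂ)) (hq' : shaAn V = (q' : ℂ))
    (hle : padicValRat p q + padicValRat p q' ≤ (padicValNat p W.shaOrder : ℤ) + (padicValNat p V.shaOrder : ℤ))
    (K : Type) [Field K] [NumberField K] {θ : K} (h2 : Module.finrank ℚ K = 2) (hθ : θ ^ 2 = (d : K)) :
    ∃ qK : ℚ, analyticSha (W.baseChange K) = (qK : ℂ) ∧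
      padicValRat p qK ≤ (padicValNat p (W.baseChange K).shaOrder : ℤ) := by
  obtain ⟨hKfin, hq0, hq0', hqK⟩ :=
    analyticSha_baseChange_eq_ratCast hE hMilne W V hd hC hWfin hVfin hq hq' K h2 hθ
  refine ⟨_, hqK, ?_⟩
  haveI : (W.baseChange K).IsElliptic := by
    rw [WeierstrassCurve.baseChange]; infer_instance
  have hsW : W.shaOrder ≠ 0 := (W.shaOrder_pos hWfin).ne'
  have hsV : V.shaOrder ≠ 0 := (V.shaOrder_pos hVfin).ne'
  have hsK : (W.baseChange K).shaOrder ≠ 0 := ((W.baseChange K).shaOrder_pos hKfin).ne'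
  have hQ : (q * q' * (W.baseChange K).shaOrder / (W.shaOrder * V.shaOrder)) * W.shaOrder * V.shaOrder =
      q * q' * (W.baseChange K).shaOrder := by
    have hsWq : (W.shaOrder : ℚ) ≠ 0 := by exact_mod_cast hsW
    have hsVq : (V.shaOrder : ℚ) ≠ 0 := by exact_mod_cast hsV
    field_simp
  exact RamifiedPairLowerBound.padicValRat_le_of_mul_eq p hq0 hq0' hsW hsV hsK hQ hle

/-- **Upper reading at `p`.** In the situation of `analyticSha_baseChange_eq_ratCast`, the pair's UPPER
inequality `ord_p #Ш(W) + ord_p #Ш(V) ≤ ord_p #Ш_an(W) + ord_p #Ш_an(V)` (the X2 body's conclusion at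
`(W, V)`) gives the upper (Euler-system) half of `BSD_p(W_K/K)`: `#Ш_an(W_K/K)` is a rational `qK` with
`ord_p #Ш(W_K/K) ≤ ord_p qK`. [cite: Milne1972ArithmeticAV, §1 Thm. 1]
[cite: Miller2011LMS, §1 and Def. 1.1 (arXiv:1010.2431 p. 3)] -/
theorem upperHalfOverK_of_pairUpper (p : ℕ) [Fact p.Prime] (hE : hasEntireLFunction_rat)
    (hMilne : Milne1972.bsdQuotient_baseChange_quadratic_anyModel)
    (W : WeierstrassCurve ℚ) [W.IsElliptic] [W.IsGloballyMinimal]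
    (V : WeierstrassCurve ℚ) [V.IsElliptic] [V.IsGloballyMinimal] {d : ℤ} (hd : ¬ IsSquare (d : ℚ))
    (hC : ∃ C : WeierstrassCurve.VariableChange ℚ, C • W.quadraticTwist (d : ℚ) = V)
    (hWfin : W.ShaFinite) (hVfin : V.ShaFinite)
    {q q' : ℚ} (hq : shaAn W = (q : ℂ)) (hq' : shaAn V = (q' : ℂ))
    (hge : (padicValNat p W.shaOrder : ℤ) + (padicValNat p V.shaOrder : ℤ) ≤ padicValRat p q + padicValRat p q')
    (K : Type) [Field K] [NumberField K] {θ : K} (h2 : Module.finrank ℚ K = 2) (hθ : θ ^ 2 = (d : K)) :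
    ∃ qK : ℚ, analyticSha (W.baseChange K) = (qK : ℂ) ∧
      (padicValNat p (W.baseChange K).shaOrder : ℤ) ≤ padicValRat p qK := by
  obtain ⟨hKfin, hq0, hq0', hqK⟩ :=
    analyticSha_baseChange_eq_ratCast hE hMilne W V hd hC hWfin hVfin hq hq' K h2 hθ
  refine ⟨_, hqK, ?_⟩
  haveI : (W.baseChange K).IsElliptic := by
    rw [WeierstrassCurve.baseChange]; infer_instance
  have hsW : W.shaOrder ≠ 0 := (W.shaOrder_pos hWfin).ne'
  have hsV : V.shaOrder ≠ 0 := (V.shaOrder_pos hVfin).ne'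
  have hsK : (W.baseChange K).shaOrder ≠ 0 := ((W.baseChange K).shaOrder_pos hKfin).ne'
  have hQ : (q * q' * (W.baseChange K).shaOrder / (W.shaOrder * V.shaOrder)) * W.shaOrder * V.shaOrder =
      q * q' * (W.baseChange K).shaOrder := by
    have hsWq : (W.shaOrder : ℚ) ≠ 0 := by exact_mod_cast hsW
    have hsVq : (V.shaOrder : ℚ) ≠ 0 := by exact_mod_cast hsV
    field_simp
  exact RamifiedPairUpperBound.padicValRat_natCast_le_of_mul_eq p hq0 hq0' hsW hsV hsK hQ hge

/-- **Exact reading at `p`: `BSD(W_K/K, p)`.** In the situation of `analyticSha_baseChange_eq_ratCast`, BOTH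
pair inequalities at `p` (i.e. `ord_p #Ш_an(W) + ord_p #Ш_an(V) = ord_p #Ш(W) + ord_p #Ш(V)`) give Miller's
`BSD(E/K, p)` for `E = W` over every quadratic `K = ℚ(θ)`, `θ² = d` — the tree's
`BSDpOver (W.baseChange K) p`: `Ш(W_K/K)[p^∞]` finite and `#Ш_an(W_K/K)` a rational of `p`-adic valuation
`ord_p #Ш(W_K/K)`. [cite: Milne1972ArithmeticAV, §1 Thm. 1]
[cite: DokchitserDokchitserAnnals2010, §2.1 Notation (arXiv p. 5) and proof of Thm. 2.3]
[cite: Miller2011LMS, §1 and Def. 1.1 (arXiv:1010.2431 p. 3)] -/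
theorem bsdpOver_baseChange_of_pair (p : ℕ) [Fact p.Prime] (hE : hasEntireLFunction_rat)
    (hMilne : Milne1972.bsdQuotient_baseChange_quadratic_anyModel)
    (W : WeierstrassCurve ℚ) [W.IsElliptic] [W.IsGloballyMinimal]
    (V : WeierstrassCurve ℚ) [V.IsElliptic] [V.IsGloballyMinimal] {d : ℤ} (hd : ¬ IsSquare (d : ℚ))
    (hC : ∃ C : WeierstrassCurve.VariableChange ℚ, C • W.quadraticTwist (d : ℚ) = V)
    (hWfin : W.ShaFinite) (hVfin : V.ShaFinite)
    {q q' : ℚ} (hq : shaAn W = (q : ℂ)) (hq' : shaAn V = (q' : ℂ))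
    (hle : padicValRat p q + padicValRat p q' ≤ (padicValNat p W.shaOrder : ℤ) + (padicValNat p V.shaOrder : ℤ))
    (hge : (padicValNat p W.shaOrder : ℤ) + (padicValNat p V.shaOrder : ℤ) ≤ padicValRat p q + padicValRat p q')
    (K : Type) [Field K] [NumberField K] {θ : K} (h2 : Module.finrank ℚ K = 2) (hθ : θ ^ 2 = (d : K)) :
    BSDpOver (W.baseChange K) p := by
  obtain ⟨hKfin, hq0, hq0', hqK⟩ :=
    analyticSha_baseChange_eq_ratCast hE hMilne W V hd hC hWfin hVfin hq hq' K h2 hθ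
  haveI : (W.baseChange K).IsElliptic := by
    rw [WeierstrassCurve.baseChange]; infer_instance
  have hsW : W.shaOrder ≠ 0 := (W.shaOrder_pos hWfin).ne'
  have hsV : V.shaOrder ≠ 0 := (V.shaOrder_pos hVfin).ne'
  have hsK : (W.baseChange K).shaOrder ≠ 0 := ((W.baseChange K).shaOrder_pos hKfin).ne'
  have hQ : (q * q' * (W.baseChange K).shaOrder / (W.shaOrder * V.shaOrder)) * W.shaOrder * V.shaOrder =
      q * q' * (W.baseChange K).shaOrder := by
    have hsWq : (W.shaOrder : ℚ) ≠ 0 := by exact_mod_cast hsW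
    have hsVq : (V.shaOrder : ℚ) ≠ 0 := by exact_mod_cast hsV
    field_simp
  have h₁ := RamifiedPairLowerBound.padicValRat_le_of_mul_eq p hq0 hq0' hsW hsV hsK hQ hle
  have h₂ := RamifiedPairUpperBound.padicValRat_natCast_le_of_mul_eq p hq0 hq0' hsW hsV hsK hQ hge
  exact (bsdpOver_iff_of_shaFinite (W.baseChange K) p hKfin).mpr ⟨_, hqK, le_antisymm h₁ h₂⟩

/-! ## §2 In the stubs' literal currency: the crux bodies AT `(W, V, d)` give the over-`K` halves AT `(W, V, d)` -/

/-- **X1 at `(W, V, d)` ⇒ `stub_lowerHalfOverK` at `(W, V, d)`** (pointwise form of the lead's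
`RamifiedPairLowerBound.lowerHalfOverK_of_ramifiedPairLowerBound`, which consumes the GLOBAL crux): GIVEN
`hGZK` (the route's `PublishedInputGZK`), `hE`, `hMilne`, if the body of `RamifiedPairLowerBound` holds at one
triple `(W, V, d)` then the body of the registered stub `stub_lowerHalfOverK` holds at the same triple — for
every quadratic `K = ℚ(θ)`, `θ² = d`. Finiteness over `ℚ` comes from `hGZK` and `r_an(W) + r_an(V) = 1`; `d`
is no square since `ord₃ d = 1`. [cite: Milne1972ArithmeticAV, §1 Thm. 1]
[cite: Miller2011LMS, §1 and Def. 1.1 (arXiv:1010.2431 p. 3)] -/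
theorem lowerHalfOverKAt_of_pairLowerAt
    (hGZK : rank_eq_analyticRank_of_analyticRank_le_one) (hE : hasEntireLFunction_rat)
    (hMilne : Milne1972.bsdQuotient_baseChange_quadratic_anyModel)
    (W : WeierstrassCurve ℚ) [W.IsElliptic] [W.IsGloballyMinimal]
    (V : WeierstrassCurve ℚ) [V.IsElliptic] [V.IsGloballyMinimal] (d : ℤ)
    (hpair : ¬ W.HasCM → Addv W 3 → Summit.BirchSwinnertonDyer.Rank1Residual.Additive.SubGss W 3 →
      d < 0 → padicValInt 3 d = 1 → Squarefree d →
      (∃ C : WeierstrassCurve.VariableChange ℚ, C • W.quadraticTwist (d : ℚ) = V) →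
      GoodSS V 3 → W.analyticRank + V.analyticRank = 1 →
      ∃ q q' : ℚ, shaAn W = (q : ℂ) ∧ shaAn V = (q' : ℂ) ∧
        padicValRat 3 q + padicValRat 3 q' ≤ (padicValNat 3 W.shaOrder : ℤ) + (padicValNat 3 V.shaOrder : ℤ)) :
    ¬ W.HasCM → Addv W 3 → Summit.BirchSwinnertonDyer.Rank1Residual.Additive.SubGss W 3 →
      d < 0 → padicValInt 3 d = 1 → Squarefree d →
      (∃ C : WeierstrassCurve.VariableChange ℚ, C • W.quadraticTwist (d : ℚ) = V) →
      GoodSS V 3 → W.analyticRank + V.analyticRank = 1 →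
      ∀ (K : Type) [Field K] [NumberField K] (θ : K), Module.finrank ℚ K = 2 → θ ^ 2 = (d : K) →
        (W.baseChange K).ShaFinite →
        ∃ q : ℚ, analyticSha (W.baseChange K) = (q : ℂ) ∧
          padicValRat 3 q ≤ (padicValNat 3 (W.baseChange K).shaOrder : ℤ) := by
  intro hCM hadd hsub hdn hv hsq hC hss hsum K _ _ θ h2 hθ _
  have hrW : W.analyticRank ≤ 1 := by omega
  have hrV : V.analyticRank ≤ 1 := by omega
  obtain ⟨q, q', hq, hq', hle⟩ := hpair hCM hadd hsub hdn hv hsq hC hss hsum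
  exact lowerHalfOverK_of_pairLower 3 hE hMilne W V
    (SolventPairLowerBound.not_isSquare_ratCast_of_padicValInt_eq_one 3 hv) hC
    (hGZK W hrW).2 (hGZK V hrV).2 hq hq' hle K h2 hθ

/-- **X2 at `(W, V, d)` ⇒ `stub_upperHalfOverK` at `(W, V, d)`** (pointwise form of the lead's
`RamifiedPairUpperBound.upperHalfOverK_of_ramifiedPairUpperBound`): GIVEN `hGZK`, `hE`, `hMilne`, if the body
of `RamifiedPairUpperBound` holds at one triple `(W, V, d)` then the body of the registered stub
`stub_upperHalfOverK` holds at the same triple, for every quadratic `K = ℚ(θ)`, `θ² = d`.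
[cite: Milne1972ArithmeticAV, §1 Thm. 1] [cite: Miller2011LMS, §1 and Def. 1.1 (arXiv:1010.2431 p. 3)] -/
theorem upperHalfOverKAt_of_pairUpperAt
    (hGZK : rank_eq_analyticRank_of_analyticRank_le_one) (hE : hasEntireLFunction_rat)
    (hMilne : Milne1972.bsdQuotient_baseChange_quadratic_anyModel)
    (W : WeierstrassCurve ℚ) [W.IsElliptic] [W.IsGloballyMinimal]
    (V : WeierstrassCurve ℚ) [V.IsElliptic] [V.IsGloballyMinimal] (d : ℤ)
    (hpair : ¬ W.HasCM → Addv W 3 → Summit.BirchSwinnertonDyer.Rank1Residual.Additive.SubGss W 3 →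
      d < 0 → padicValInt 3 d = 1 → Squarefree d →
      (∃ C : WeierstrassCurve.VariableChange ℚ, C • W.quadraticTwist (d : ℚ) = V) →
      GoodSS V 3 → W.analyticRank + V.analyticRank = 1 →
      ∃ q q' : ℚ, shaAn W = (q : ℂ) ∧ shaAn V = (q' : ℂ) ∧
        (padicValNat 3 W.shaOrder : ℤ) + (padicValNat 3 V.shaOrder : ℤ) ≤ padicValRat 3 q + padicValRat 3 q') :
    ¬ W.HasCM → Addv W 3 → Summit.BirchSwinnertonDyer.Rank1Residual.Additive.SubGss W 3 →
      d < 0 → padicValInt 3 d = 1 → Squarefree d →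
      (∃ C : WeierstrassCurve.VariableChange ℚ, C • W.quadraticTwist (d : ℚ) = V) →
      GoodSS V 3 → W.analyticRank + V.analyticRank = 1 →
      ∀ (K : Type) [Field K] [NumberField K] (θ : K), Module.finrank ℚ K = 2 → θ ^ 2 = (d : K) →
        (W.baseChange K).ShaFinite →
        ∃ q : ℚ, analyticSha (W.baseChange K) = (q : ℂ) ∧
          (padicValNat 3 (W.baseChange K).shaOrder : ℤ) ≤ padicValRat 3 q := by
  intro hCM hadd hsub hdn hv hsq hC hss hsum K _ _ θ h2 hθ _
  have hrW : W.analyticRank ≤ 1 := by omega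
  have hrV : V.analyticRank ≤ 1 := by omega
  obtain ⟨q, q', hq, hq', hge⟩ := hpair hCM hadd hsub hdn hv hsq hC hss hsum
  exact upperHalfOverK_of_pairUpper 3 hE hMilne W V
    (SolventPairLowerBound.not_isSquare_ratCast_of_padicValInt_eq_one 3 hv) hC
    (hGZK W hrW).2 (hGZK V hrV).2 hq hq' hge K h2 hθ

end Summit.BirchSwinnertonDyer.BirchSwinnertonDyer.Theorems.RamifiedHeegnerPairRungOverK

end
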